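import Literature.NumberTheory.EllipticCurves.ModularFormsGamma0Genus
import Literature.NumberTheory.EllipticCurves.ModularFormsLevelRank
import HarnessLib

/-!
# The cusp constraint `∑ k_j = 6([SL₂(ℤ) : Γ] - ε_∞(Γ))` on the generator weights of `M(Γ)`, for a
# finite-index level `Γ ∋ T, -1` (the level-general form of the cusp count of `ModularFormsGamma0Genus`)

`ModularFormsGamma0Genus` proved Gannon's cusp constraint `∑_j k_j = 6(μ - ν_∞)` (Thm. 3.4(b):
`∑ w = 12 Tr λ`) for a level-one basis of `M(Γ₀(N))`, from the behaviour at `i∞` of the determinant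
`𝒟` of the basis-conjugate matrix: `‖𝒟‖e^{2πty} → ‖det M₀‖/‖det L‖ ≠ 0` with `2t = μ - ν_∞`,
against `‖𝒟‖¹²e^{2πKy} → ‖c‖ ≠ 0` (`𝒟¹² = cΔ^K`). The argument uses the level only through the
`T`-orbits on `SL₂(ℤ)/Γ₀(N)` (widths, base points, offsets) and `𝒟 ≢ 0`; this file is its
**verbatim generalisation to a finite-index `Γ ≤ SL₂(ℤ)`** (sub-namespace `Level`, continuing
`ModularFormsLevelFreeModule` / `ModularFormsLevelRank`), with `ν_∞` replaced by the number
`#(Level.basePoints Γ)` of `T`-orbits on `SL₂(ℤ)/Γ` (`Level.basePointsEquiv`: base points `≃`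
`⟨T⟩`-orbits, i.e. the cusps of `Γ` when `-1 ∈ Γ`), the trivial action of `Tᴺ` replaced by "some
positive power of `T` fixes each coset" (`Level.exists_pos_T_pow_smul`), and `𝒟 ≢ 0` supplied by a
`Level.RankInput Γ`:

* `Level.width`, `Level.orbitFin`, `Level.base`, `Level.off`, `Level.basePoints`,
  `Level.basePointsEquiv` (orbits of `T` on `SL₂(ℤ)/Γ`);
* `Level.rowFun`, `Level.dftMat`, `Level.projMat`, `Level.coefMat`, `Level.limMat`, `Level.qFactor`,
  `Level.cuspExp`, `Level.limMat_mulVec_eq_zero` (**`M₀` is non-singular**), `Level.det_limMat_ne_zero`,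
  `Level.totalWeight_eq_twelve_mul_cuspExp`, `Level.two_mul_cuspExp`
  (`2t = [SL₂(ℤ):Γ] - #basePoints`), and **`Level.totalWeight_eq`**:
  `∑ k_j + 6 #basePoints(Γ) = 6 [SL₂(ℤ) : Γ]`.

The `1`-periodic-growth and twisted-average lemmas (`tendsto_atImInfty_of_norm_le_exp`, `twistAvg`,
`coeffAt`, …) are those of `ModularFormsGamma0Genus` (level-free) and are used from there. All proofs
are those of the `Γ₀(N)` file; no named facts. With `ModularFormsGamma1RankInput` this gives, for
`Γ = ±Γ₁(N)`, all of Gannon's constraints, whence the dimension of `M_k(Γ₁(N))` in large even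
weight by the bookkeeping of `ModularFormsGamma0Dimension` (sequel).

## References

* T. Gannon, *The theory of vector-valued modular forms for the modular group*, Contrib. Math.
  Comput. Sci. 8, Springer (2014), 247–286 (arXiv:1310.4458), Thm. 3.4(b) and its proof, §3.5.
* C. Marks, G. Mason, *Structure of the module of vector-valued modular forms*, J. London Math.
  Soc. (2) 82 (2010), 32–48, §3.
-/

noncomputable section

open UpperHalfPlane hiding I
open ModularForm Complex Matrix.SpecialLinearGroup Filter Asymptotics CongruenceSubgroup
open EisensteinSeries ModularGroup
open scoped MatrixGroups Real ModularForm Topology Manifold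

namespace Literature.NumberTheory.EllipticCurves.ModularForms

namespace Level

section Orbits

variable (Γ : Subgroup SL(2, ℤ)) [Γ.FiniteIndex]

local notation "𝕏" => SL(2, ℤ) ⧸ Γ

open scoped Classical

/-- **Some positive power of `T` fixes every coset** (`(g⁻¹Tg)ⁿ ∈ Γ` for some `0 < n`, by
finiteness of the index). [folklore] -/
theorem exists_pos_T_pow_smul (x : 𝕏) : ∃ n : ℕ, 0 < n ∧ (ModularGroup.T ^ n) • x = x := by
  induction x using QuotientGroup.induction_on with
  | H g =>
    obtain ⟨n, hn, -, hmem⟩ := Subgroup.exists_pow_mem_of_index_ne_zero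
      (Subgroup.index_ne_zero_of_finite (H := Γ)) (g⁻¹ * ModularGroup.T * g)
    refine ⟨n, hn, ?_⟩
    rw [MulAction.Quotient.smul_mk, QuotientGroup.eq]
    have hconj : (g⁻¹ * ModularGroup.T * g) ^ n = g⁻¹ * ModularGroup.T ^ n * g := by
      have : g⁻¹ * ModularGroup.T * g = g⁻¹ * ModularGroup.T * g⁻¹⁻¹ := by rw [inv_inv]
      rw [this, conj_pow, inv_inv]
    rw [hconj] at hmem
    have := inv_mem hmem
    convert this using 1
    rw [smul_eq_mul]
    group

/-- The **width** `w(x)` of the cusp through `x`: the period of `T` on the coset `x`. [folklore] -/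
def width (x : 𝕏) : ℕ := MulAction.period ModularGroup.T x

/-- `0 < w(x)`. [folklore] -/
theorem width_pos (x : 𝕏) : 0 < width Γ x := by
  obtain ⟨n, hn, hfix⟩ := exists_pos_T_pow_smul Γ x
  exact MulAction.period_pos_of_fixed hn hfix

omit [Γ.FiniteIndex] in
/-- `T^{w(x)} x = x`. [folklore] -/
theorem T_pow_width_smul (x : 𝕏) : ModularGroup.T ^ width Γ x • x = x := MulAction.pow_period_smul _ _

omit [Γ.FiniteIndex] in
/-- Periodicity modulo the width: `T^i x = T^{i % w} x`. [folklore] -/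
theorem T_pow_mod_width_smul (x : 𝕏) (i : ℕ) : ModularGroup.T ^ (i % width Γ x) • x = ModularGroup.T ^ i • x :=
  MulAction.pow_mod_period_smul i

omit [Γ.FiniteIndex] in
/-- `T^i x = x ↔ w(x) ∣ i`. [folklore] -/
theorem T_pow_smul_eq_iff (x : 𝕏) (i : ℕ) : ModularGroup.T ^ i • x = x ↔ width Γ x ∣ i :=
  MulAction.pow_smul_eq_iff_period_dvd

omit [Γ.FiniteIndex] in
/-- Injectivity of `i ↦ T^i x` below the width. [folklore] -/
theorem T_pow_smul_injOn (x : 𝕏) {i i' : ℕ} (hi : i < width Γ x) (hi' : i' < width Γ x)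
    (h : ModularGroup.T ^ i • x = ModularGroup.T ^ i' • x) : i = i' := by
  have key : ∀ i i' : ℕ, i' < width Γ x → i < i' →
      ModularGroup.T ^ i • x = ModularGroup.T ^ i' • x → False := by
    intro i i' hi' hlt h
    have hfix : ModularGroup.T ^ (i' - i) • x = x := by
      have e : ModularGroup.T ^ i • (ModularGroup.T ^ (i' - i) • x) = ModularGroup.T ^ i • x := by
        rw [smul_smul, ← pow_add, Nat.add_sub_cancel' hlt.le, ← h]
      exact smul_left_cancel _ e
    exact MulAction.pow_smul_ne_of_lt_period (by omega) (by unfold width at hi'; omega) hfix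
  by_contra hne
  rcases Nat.lt_or_gt_of_ne hne with hlt | hlt
  · exact key i i' hi' hlt h
  · exact key i' i hi hlt h.symm

/-- The width is constant along `T`-orbits. [folklore] -/
theorem width_T_pow_smul (x : 𝕏) (i : ℕ) : width Γ (ModularGroup.T ^ i • x) = width Γ x := by
  have hx : x ∈ Function.periodicPts (fun y : 𝕏 ↦ ModularGroup.T • y) :=
    Function.mem_periodicPts.mpr ⟨width Γ x, width_pos Γ x, by
      rw [Function.IsPeriodicPt, Function.IsFixedPt, smul_iterate_apply]
      exact T_pow_width_smul Γ x⟩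
  have := Function.minimalPeriod_apply_iterate hx i
  rw [smul_iterate_apply] at this
  exact this

/-- The `T`-orbit of `x` as a finset: `{T^i x : i < w(x)}`. [folklore] -/
def orbitFin (x : 𝕏) : Finset 𝕏 := (Finset.range (width Γ x)).image fun i ↦ ModularGroup.T ^ i • x

omit [Γ.FiniteIndex] in
/-- Membership in `orbitFin`. [folklore] -/
theorem mem_orbitFin {x y : 𝕏} : y ∈ orbitFin Γ x ↔ ∃ i < width Γ x, ModularGroup.T ^ i • x = y := by
  simp [orbitFin]

/-- `x ∈ orbitFin x`. [folklore] -/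
theorem self_mem_orbitFin (x : 𝕏) : x ∈ orbitFin Γ x :=
  (mem_orbitFin Γ).mpr ⟨0, width_pos Γ x, by simp⟩

/-- Every `T^i x` lies in `orbitFin x`. [folklore] -/
theorem T_pow_smul_mem_orbitFin (x : 𝕏) (i : ℕ) : ModularGroup.T ^ i • x ∈ orbitFin Γ x :=
  (mem_orbitFin Γ).mpr ⟨i % width Γ x, Nat.mod_lt _ (width_pos Γ x), T_pow_mod_width_smul Γ x i⟩

omit [Γ.FiniteIndex] in
/-- `#orbitFin x = w(x)`. [folklore] -/
theorem card_orbitFin (x : 𝕏) : (orbitFin Γ x).card = width Γ x := by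
  rw [orbitFin, Finset.card_image_of_injOn, Finset.card_range]
  intro i hi i' hi' h
  exact T_pow_smul_injOn Γ x (Finset.mem_range.mp hi) (Finset.mem_range.mp hi') h

/-- Membership in `orbitFin` with an unbounded exponent. [folklore] -/
theorem mem_orbitFin' {x y : 𝕏} : y ∈ orbitFin Γ x ↔ ∃ i : ℕ, ModularGroup.T ^ i • x = y := by
  rw [mem_orbitFin]
  constructor
  · rintro ⟨i, -, h⟩
    exact ⟨i, h⟩
  · rintro ⟨i, rfl⟩
    exact ⟨i % width Γ x, Nat.mod_lt _ (width_pos Γ x), T_pow_mod_width_smul Γ x i⟩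

/-- Symmetry of the orbit relation: if `T^i x = y` then `T^{i'} y = x` for some `i'`. [folklore] -/
theorem exists_T_pow_smul_eq_of_T_pow_smul_eq {x y : 𝕏} {i : ℕ} (h : ModularGroup.T ^ i • x = y) :
    ∃ i' : ℕ, ModularGroup.T ^ i' • y = x := by
  refine ⟨width Γ x - i % width Γ x, ?_⟩
  rw [← h, smul_smul, ← pow_add, T_pow_smul_eq_iff]
  have hr : i % width Γ x ≤ i := Nat.mod_le _ _
  have hr' : i % width Γ x < width Γ x := Nat.mod_lt _ (width_pos Γ x)
  have : width Γ x - i % width Γ x + i = width Γ x + (i - i % width Γ x) := by omega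
  rw [this]
  exact dvd_add dvd_rfl (Nat.dvd_sub_mod i)

/-- If `y ∈ orbitFin x` then the orbit finsets agree. [folklore] -/
theorem orbitFin_eq_of_mem {x y : 𝕏} (h : y ∈ orbitFin Γ x) : orbitFin Γ y = orbitFin Γ x := by
  obtain ⟨i₀, hi₀⟩ := (mem_orbitFin' Γ).mp h
  obtain ⟨i₁, hi₁⟩ := exists_T_pow_smul_eq_of_T_pow_smul_eq Γ hi₀
  ext z
  rw [mem_orbitFin', mem_orbitFin']
  constructor
  · rintro ⟨i, rfl⟩
    exact ⟨i + i₀, by rw [pow_add, mul_smul, hi₀]⟩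
  · rintro ⟨i, rfl⟩
    exact ⟨i + i₁, by rw [pow_add, mul_smul, hi₁]⟩

/-- The orbit finset is constant along the orbit. [folklore] -/
theorem orbitFin_T_pow_smul (x : 𝕏) (i : ℕ) : orbitFin Γ (ModularGroup.T ^ i • x) = orbitFin Γ x :=
  orbitFin_eq_of_mem Γ (T_pow_smul_mem_orbitFin Γ x i)

/-- The **base point** of the orbit of `x`: its element with the least index under the fixed
enumeration `SL₂(ℤ)/Γ ≃ Fin μ`. [folklore] -/
def base (x : 𝕏) : 𝕏 :=
  (cosetEquiv Γ).symm (((orbitFin Γ x).image (cosetEquiv Γ)).min'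
    ⟨cosetEquiv Γ x, Finset.mem_image_of_mem _ (self_mem_orbitFin Γ x)⟩)

/-- The base point lies in the orbit. [folklore] -/
theorem base_mem_orbitFin (x : 𝕏) : base Γ x ∈ orbitFin Γ x := by
  unfold base
  have := Finset.min'_mem ((orbitFin Γ x).image (cosetEquiv Γ))
    ⟨cosetEquiv Γ x, Finset.mem_image_of_mem _ (self_mem_orbitFin Γ x)⟩
  obtain ⟨y, hy, hy'⟩ := Finset.mem_image.mp this
  rw [← hy', Equiv.symm_apply_apply]
  exact hy

/-- The base point only depends on the orbit. [folklore] -/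
theorem base_eq_of_mem {x y : 𝕏} (h : y ∈ orbitFin Γ x) : base Γ y = base Γ x := by
  unfold base
  have e := orbitFin_eq_of_mem Γ h
  congr 2
  rw [e]

/-- `base (T^i x) = base x`. [folklore] -/
theorem base_T_pow_smul (x : 𝕏) (i : ℕ) : base Γ (ModularGroup.T ^ i • x) = base Γ x :=
  base_eq_of_mem Γ (T_pow_smul_mem_orbitFin Γ x i)

/-- `x` is in the orbit of its base point: `∃ i, T^i (base x) = x`. [folklore] -/
theorem exists_T_pow_base_smul (x : 𝕏) : ∃ i : ℕ, ModularGroup.T ^ i • base Γ x = x := by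
  obtain ⟨i, -, hi⟩ := (mem_orbitFin Γ).mp (base_mem_orbitFin Γ x)
  exact exists_T_pow_smul_eq_of_T_pow_smul_eq Γ hi

/-- The **offset** of `x` in its orbit: the least `i` with `T^i (base x) = x`. [folklore] -/
def off (x : 𝕏) : ℕ := Nat.find (exists_T_pow_base_smul Γ x)

/-- `T^{off x} (base x) = x`. [folklore] -/
theorem T_pow_off_smul_base (x : 𝕏) : ModularGroup.T ^ off Γ x • base Γ x = x := Nat.find_spec (exists_T_pow_base_smul Γ x)

/-- `w(base x) = w(x)`. [folklore] -/
theorem width_base (x : 𝕏) : width Γ (base Γ x) = width Γ x := by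
  conv_rhs => rw [← T_pow_off_smul_base Γ x]
  rw [width_T_pow_smul]

/-- `off x < w(x)`. [folklore] -/
theorem off_lt_width (x : 𝕏) : off Γ x < width Γ x := by
  obtain ⟨i', hi'⟩ := exists_T_pow_base_smul Γ x
  have h : ModularGroup.T ^ (i' % width Γ (base Γ x)) • base Γ x = x := by
    rw [T_pow_mod_width_smul, hi']
  rw [width_base] at h
  exact (Nat.find_min' _ h).trans_lt (Nat.mod_lt _ (width_pos Γ x))

/-- **The offsets enumerate the orbit**: `off (T^i (base x)) = i` for `i < w(x)`. [folklore] -/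
theorem off_T_pow_smul_base (x : 𝕏) {i : ℕ} (hi : i < width Γ x) : off Γ (ModularGroup.T ^ i • base Γ x) = i := by
  have hb : base Γ (ModularGroup.T ^ i • base Γ x) = base Γ x := by
    rw [base_T_pow_smul, base_eq_of_mem Γ (base_mem_orbitFin Γ x)]
  have h1 : ModularGroup.T ^ off Γ (ModularGroup.T ^ i • base Γ x) • base Γ x = ModularGroup.T ^ i • base Γ x := by
    have := T_pow_off_smul_base Γ (ModularGroup.T ^ i • base Γ x)
    rwa [hb] at this
  have h2 : off Γ (ModularGroup.T ^ i • base Γ x) < width Γ x := by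
    have := off_lt_width Γ (ModularGroup.T ^ i • base Γ x)
    rwa [width_T_pow_smul, width_base] at this
  exact T_pow_smul_injOn Γ (base Γ x) (by rw [width_base]; exact h2) (by rw [width_base]; exact hi) h1

end Orbits

/-! ### The DFT change of rows and the factorisation `Φ̃ = L · Φ`, `Φ̃_{a,j} = q_w^{s} · H_{a,j}` -/

section CuspOrder

variable (Γ : Subgroup SL(2, ℤ)) [Γ.FiniteIndex]

local notation "𝕏" => SL(2, ℤ) ⧸ Γ

open scoped Classical

/-- `base (base x) = base x`. [folklore] -/
theorem base_base (x : 𝕏) : base Γ (base Γ x) = base Γ x := base_eq_of_mem Γ (base_mem_orbitFin Γ x)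

/-- `NeZero (w x)`. [folklore] -/
instance neZero_width (x : 𝕏) : NeZero (width Γ x) := ⟨(width_pos Γ x).ne'⟩

variable (wt : Fin (Γ.index) → ℤ) (F : Fin (Γ.index) → ℍ → ℂ)

/-- The row function of the coset `x`: `j ↦ F_j ∣ g⁻¹` (`x = gΓ`). [folklore] -/
def rowFun (x : 𝕏) (j : Fin (Γ.index)) : ℍ → ℂ := cosetSlash Γ (wt j) (F j) x

/-- `Φ(τ)_{a,j} = rowFun (e⁻¹ a) j τ`. [folklore] -/
theorem basisMatrix_eq_rowFun (τ : ℍ) (a j : Fin (Γ.index)) :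
    basisMatrix Γ wt F τ a j = rowFun Γ wt F ((cosetEquiv Γ).symm a) j τ := rfl

variable {Γ wt F}

omit [Γ.FiniteIndex] in
/-- Translates of rows are rows: `(rowFun x j)(τ - i) = rowFun (Tⁱ x) j τ`. [folklore] -/
theorem transl_rowFun (hb : IsLevelBasis Γ wt F) (x : 𝕏) (j : Fin (Γ.index)) (i : ℕ) :
    transl (-(i : ℤ)) (rowFun Γ wt F x j) = rowFun Γ wt F (ModularGroup.T ^ i • x) j := by
  rw [← slash_T_zpow_eq_transl (wt j), rowFun, cosetSlash_slash (slash_eq_of_mem_levelSpace (hb.mem j)),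
    zpow_neg, inv_inv, zpow_natCast]
  rfl

omit [Γ.FiniteIndex] in
/-- Rows are `w(x)`-periodic. [folklore] -/
theorem rowFun_T_pow_width_smul (hb : IsLevelBasis Γ wt F) (x : 𝕏) (j : Fin (Γ.index)) (τ : ℍ) :
    rowFun Γ wt F x j ((ModularGroup.T ^ (width Γ x : ℤ)) • τ) = rowFun Γ wt F x j τ := by
  have h := slash_T_zpow_eq_transl (wt j) (width Γ x : ℤ) (rowFun Γ wt F x j)
  rw [rowFun, cosetSlash_slash (slash_eq_of_mem_levelSpace (hb.mem j)), zpow_natCast,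
    inv_smul_eq_iff.mpr (T_pow_width_smul Γ x).symm] at h
  have := congr_fun h τ
  rw [transl] at this
  exact this.symm

variable (Γ wt F)

/-- `ζ_x = e^{2πi/w(x)}`. [folklore] -/
def zetaW (x : 𝕏) : ℂ := Complex.exp (2 * π * I / width Γ x)

/-- `ζ_x` is a primitive `w(x)`-th root of unity. [folklore] -/
theorem isPrimitiveRoot_zetaW (x : 𝕏) : IsPrimitiveRoot (zetaW Γ x) (width Γ x) :=
  Complex.isPrimitiveRoot_exp _ (width_pos Γ x).ne'

/-- The **DFT row-change matrix** `L_{a,b} = w⁻¹ ∑_{i<w, Tⁱ·base = b} ζ^{off(a)·i}` (block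
diagonal over the `T`-orbits, each block a DFT matrix). [folklore] -/
def dftMat : Matrix (Fin (Γ.index)) (Fin (Γ.index)) ℂ := fun a b ↦
  ((width Γ ((cosetEquiv Γ).symm a) : ℂ))⁻¹ *
    ∑ i ∈ (Finset.range (width Γ ((cosetEquiv Γ).symm a))).filter
        (fun i ↦ ModularGroup.T ^ i • base Γ ((cosetEquiv Γ).symm a) = (cosetEquiv Γ).symm b),
      zetaW Γ ((cosetEquiv Γ).symm a) ^ (off Γ ((cosetEquiv Γ).symm a) * i)

/-- The **projected matrix** `Φ̃(τ)_{a,j} = w⁻¹ ∑_{i<w} ζ^{off(a) i} (F_j ∣ ·)(Tⁱ base(a))(τ)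
= P_{off a}(row of base(a))`. [folklore] -/
def projMat (τ : ℍ) : Matrix (Fin (Γ.index)) (Fin (Γ.index)) ℂ := fun a j ↦
  ((width Γ ((cosetEquiv Γ).symm a) : ℂ))⁻¹ *
    ∑ i ∈ Finset.range (width Γ ((cosetEquiv Γ).symm a)),
      zetaW Γ ((cosetEquiv Γ).symm a) ^ (off Γ ((cosetEquiv Γ).symm a) * i) *
        basisMatrix Γ wt F τ (cosetEquiv Γ (ModularGroup.T ^ i • base Γ ((cosetEquiv Γ).symm a))) j

/-- `L *ᵥ v` unfolded. [folklore] -/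
theorem dftMat_mulVec (v : Fin (Γ.index) → ℂ) (a : Fin (Γ.index)) :
    Matrix.mulVec (dftMat Γ) v a = ((width Γ ((cosetEquiv Γ).symm a) : ℂ))⁻¹ *
      ∑ i ∈ Finset.range (width Γ ((cosetEquiv Γ).symm a)),
        zetaW Γ ((cosetEquiv Γ).symm a) ^ (off Γ ((cosetEquiv Γ).symm a) * i) *
          v (cosetEquiv Γ (ModularGroup.T ^ i • base Γ ((cosetEquiv Γ).symm a))) := by
  simp only [Matrix.mulVec, dotProduct, dftMat, Finset.sum_filter, mul_assoc, ← Finset.mul_sum]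
  congr 1
  simp only [Finset.sum_mul, ite_mul, zero_mul]
  rw [Finset.sum_comm]
  refine Finset.sum_congr rfl fun i _ ↦ ?_
  simp_rw [Equiv.eq_symm_apply]
  rw [Finset.sum_ite_eq]
  simp

/-- **`Φ̃ = L · Φ`**. [folklore] -/
theorem projMat_eq_mul (τ : ℍ) : projMat Γ wt F τ = dftMat Γ * basisMatrix Γ wt F τ := by
  ext a j
  rw [Matrix.mul_apply']
  change _ = Matrix.mulVec (dftMat Γ) (fun b ↦ basisMatrix Γ wt F τ b j) a
  rw [dftMat_mulVec]
  rfl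

omit [Γ.FiniteIndex] in
/-- `e_w(s, τ - i) = ζ^{s i} e_w(s, τ)`. [folklore] -/
theorem twist_T_neg_pow_smul (x : 𝕏) (s i : ℕ) (τ : ℍ) :
    twist (width Γ x) s ((ModularGroup.T ^ (-(i : ℤ))) • τ) = zetaW Γ x ^ (s * i) * twist (width Γ x) s τ := by
  rw [twist_T_zpow_smul, zetaW, ← Complex.exp_nat_mul]
  congr 2
  push_cast
  ring

variable {Γ wt F}

/-- **`Φ̃_{a,j} = q_w^{off a} · K_{off a}(row of base a)_j`**. [folklore] -/
theorem projMat_apply (hb : IsLevelBasis Γ wt F) (τ : ℍ) (a j : Fin (Γ.index)) :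
    projMat Γ wt F τ a j = Function.Periodic.qParam (width Γ ((cosetEquiv Γ).symm a)) τ ^ off Γ ((cosetEquiv Γ).symm a) *
      twistAvg (width Γ ((cosetEquiv Γ).symm a)) (off Γ ((cosetEquiv Γ).symm a))
        (rowFun Γ wt F (base Γ ((cosetEquiv Γ).symm a)) j) τ := by
  set x := (cosetEquiv Γ).symm a with hx
  simp only [projMat, twistAvg]
  rw [Finset.mul_sum, Finset.mul_sum, Finset.mul_sum]
  refine Finset.sum_congr rfl fun i _ ↦ ?_
  have hz : zetaW Γ (base Γ x) = zetaW Γ x := by rw [zetaW, zetaW, width_base]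
  have h1 : transl (-(i : ℤ)) (fun σ ↦ rowFun Γ wt F (base Γ x) j σ * twist (width Γ x) (off Γ x) σ) τ =
      rowFun Γ wt F (ModularGroup.T ^ i • base Γ x) j τ * (zetaW Γ x ^ (off Γ x * i) * twist (width Γ x) (off Γ x) τ) := by
    have := congr_fun (transl_rowFun hb (base Γ x) j i) τ
    simp only [transl] at this ⊢
    have htw := twist_T_neg_pow_smul Γ (base Γ x) (off Γ x) i τ
    rw [width_base, hz] at htw
    rw [this, htw]
  rw [h1, basisMatrix_eq_rowFun, Equiv.symm_apply_apply]
  have h2 := twist_mul_qParam_pow (width Γ x) (off Γ x) τ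
  linear_combination (-(((width Γ x : ℂ))⁻¹ * rowFun Γ wt F (ModularGroup.T ^ i • base Γ x) j τ *
    zetaW Γ x ^ (off Γ x * i))) * h2

/-- **`L` is invertible**: on each `T`-orbit `L` is `w⁻¹ (ζ^{r m})_{r,m<w}`, a Vandermonde matrix in
the distinct roots of unity `ζ^r`. [folklore] -/
theorem det_dftMat_ne_zero : (dftMat Γ).det ≠ 0 := by
  intro hdet
  obtain ⟨v, hv, hLv⟩ := (Matrix.exists_mulVec_eq_zero_iff (M := dftMat Γ)).mpr hdet
  apply hv
  funext b
  -- the orbit through `y = e⁻¹ b`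
  set y := (cosetEquiv Γ).symm b with hy
  set w := width Γ y with hw
  set u : Fin w → ℂ := fun i ↦ v (cosetEquiv Γ (ModularGroup.T ^ (i : ℕ) • base Γ y)) with hu
  have hprim := isPrimitiveRoot_zetaW Γ y
  have hu0 : u = 0 := by
    refine Matrix.eq_zero_of_forall_index_sum_mul_pow_eq_zero (f := fun r : Fin w ↦ zetaW Γ y ^ (r : ℕ))
      (fun r r' h ↦ Fin.ext (hprim.pow_inj r.2 r'.2 h)) fun r ↦ ?_
    -- row `a_r = e (T^r base y)` of `L v = 0`
    have hrow := congr_fun hLv (cosetEquiv Γ (ModularGroup.T ^ (r : ℕ) • base Γ y))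
    rw [dftMat_mulVec, Pi.zero_apply, Equiv.symm_apply_apply, width_T_pow_smul, width_base,
      base_T_pow_smul, base_base, off_T_pow_smul_base Γ y r.2, mul_eq_zero] at hrow
    have hw0 : ((width Γ y : ℂ))⁻¹ ≠ 0 := inv_ne_zero (by exact_mod_cast (width_pos Γ y).ne')
    replace hrow := hrow.resolve_left hw0
    rw [← hrow, ← hw, Finset.sum_range]
    refine Finset.sum_congr rfl fun i _ ↦ ?_
    have hz : zetaW Γ (ModularGroup.T ^ (r : ℕ) • base Γ y) = zetaW Γ y := by
      rw [zetaW, zetaW, width_T_pow_smul, width_base]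
    rw [hz, hu, ← pow_mul, mul_comm]
  have : v b = u ⟨off Γ y, off_lt_width Γ y⟩ := by
    simp only [hu, T_pow_off_smul_base, hy, Equiv.apply_symm_apply]
  rw [this, hu0, Pi.zero_apply, Pi.zero_apply]

variable (Γ wt F)

/-- The **coefficient matrix** `H(τ)_{a,j} = K_{off a}(row of base a)_j(τ)`. [folklore] -/
def coefMat (τ : ℍ) : Matrix (Fin (Γ.index)) (Fin (Γ.index)) ℂ := fun a j ↦
  twistAvg (width Γ ((cosetEquiv Γ).symm a)) (off Γ ((cosetEquiv Γ).symm a))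
    (rowFun Γ wt F (base Γ ((cosetEquiv Γ).symm a)) j) τ

/-- The **limit matrix** `M₀_{a,j}` = the `off a`-th `q_w`-coefficient of `F_j ∣ (base a)`. [folklore] -/
def limMat : Matrix (Fin (Γ.index)) (Fin (Γ.index)) ℂ := fun a j ↦
  coeffAt (w := width Γ ((cosetEquiv Γ).symm a)) (off Γ ((cosetEquiv Γ).symm a))
    (rowFun Γ wt F (base Γ ((cosetEquiv Γ).symm a)) j)

/-- The row factor `q_{w(a)}(τ)^{off a}`. [folklore] -/
def qFactor (a : Fin (Γ.index)) (τ : ℍ) : ℂ :=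
  Function.Periodic.qParam (width Γ ((cosetEquiv Γ).symm a)) τ ^ off Γ ((cosetEquiv Γ).symm a)

/-- The **cusp exponent** `t = ∑_a off(a)/w(a)` (shown below to be `(μ - ν_∞)/2`). [folklore] -/
def cuspExp : ℝ := ∑ a : Fin (Γ.index), (off Γ ((cosetEquiv Γ).symm a) : ℝ) / width Γ ((cosetEquiv Γ).symm a)

variable {Γ wt F}

/-- **`det Φ̃ = (∏_a q_{w_a}^{off a}) · det H`**. [folklore] -/
theorem det_projMat (hb : IsLevelBasis Γ wt F) (τ : ℍ) :
    (projMat Γ wt F τ).det = (∏ a, qFactor Γ a τ) * (coefMat Γ wt F τ).det := by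
  rw [← Matrix.det_mul_column]
  congr 1
  ext a j
  rw [projMat_apply hb]
  rfl

/-- `‖∏_a q_{w_a}(τ)^{off a}‖ = e^{-2π t Im τ}`. [folklore] -/
theorem norm_prod_qFactor (τ : ℍ) : ‖∏ a, qFactor Γ a τ‖ = Real.exp (-2 * π * cuspExp Γ * τ.im) := by
  rw [norm_prod, cuspExp, Finset.mul_sum, Finset.sum_mul, Real.exp_sum]
  refine Finset.prod_congr rfl fun a _ ↦ ?_
  rw [qFactor, norm_pow, Function.Periodic.norm_qParam, ← Real.exp_nat_mul, UpperHalfPlane.coe_im]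
  congr 1
  have hw : (width Γ ((cosetEquiv Γ).symm a) : ℝ) ≠ 0 := by exact_mod_cast (width_pos Γ _).ne'
  field_simp

/-- `H(τ) → M₀` entrywise at `i∞`. [folklore] -/
theorem tendsto_coefMat (hb : IsLevelBasis Γ wt F) (a j : Fin (Γ.index)) :
    Tendsto (fun τ ↦ coefMat Γ wt F τ a j) atImInfty (𝓝 (limMat Γ wt F a j)) := by
  set x := (cosetEquiv Γ).symm a
  refine tendsto_twistAvg (off_lt_width Γ x) (fun τ ↦ ?_) (mdifferentiable_cosetSlash (hb.mem j) _)
    (isBoundedAtImInfty_cosetSlash (hb.mem j) _)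
  have := rowFun_T_pow_width_smul hb (base Γ x) j τ
  rwa [width_base] at this

/-- `det H(τ) → det M₀` at `i∞`. [folklore] -/
theorem tendsto_det_coefMat (hb : IsLevelBasis Γ wt F) :
    Tendsto (fun τ ↦ (coefMat Γ wt F τ).det) atImInfty (𝓝 (limMat Γ wt F).det) := by
  have hH : Tendsto (coefMat Γ wt F) atImInfty (𝓝 (limMat Γ wt F)) :=
    tendsto_pi_nhds.mpr fun a ↦ tendsto_pi_nhds.mpr fun j ↦ tendsto_coefMat hb a j
  exact ((continuous_id.matrix_det).tendsto _).comp hH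

/-- **DFT inversion**: `∑_{r<w} q_w^r K_r(G) = G` for `w`-periodic `G`. [folklore] -/
theorem sum_qParam_pow_mul_twistAvg (x : 𝕏) {G : ℍ → ℂ} (τ : ℍ) :
    ∑ r ∈ Finset.range (width Γ x), Function.Periodic.qParam (width Γ x) τ ^ r * twistAvg (width Γ x) r G τ = G τ := by
  set w := width Γ x with hw
  have hprim := isPrimitiveRoot_zetaW Γ x
  -- each term: `q^r K_r = w⁻¹ ∑_i ζ^{ri} G(τ - i)`
  have hterm : ∀ r, Function.Periodic.qParam w τ ^ r * twistAvg w r G τ =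
      (w : ℂ)⁻¹ * ∑ i ∈ Finset.range w, zetaW Γ x ^ (r * i) * G ((ModularGroup.T ^ (-(i : ℤ))) • τ) := by
    intro r
    simp only [twistAvg]
    rw [Finset.mul_sum, Finset.mul_sum, Finset.mul_sum]
    refine Finset.sum_congr rfl fun i _ ↦ ?_
    simp only [transl]
    rw [twist_T_neg_pow_smul]
    have h2 := twist_mul_qParam_pow w r τ
    linear_combination ((w : ℂ)⁻¹ * zetaW Γ x ^ (r * i) * G ((ModularGroup.T ^ (-(i : ℤ))) • τ)) * h2
  simp_rw [hterm]
  rw [← Finset.mul_sum, Finset.sum_comm]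
  -- geometric sums
  have hgeom : ∀ i ∈ Finset.range w, ∑ r ∈ Finset.range w, zetaW Γ x ^ (r * i) * G ((ModularGroup.T ^ (-(i : ℤ))) • τ) =
      if i = 0 then (w : ℂ) * G τ else 0 := by
    intro i hi
    rw [← Finset.sum_mul]
    split_ifs with h0
    · subst h0
      simp
    · have hne : zetaW Γ x ^ i ≠ 1 := hprim.pow_ne_one_of_pos_of_lt h0 (Finset.mem_range.mp hi)
      have : ∑ r ∈ Finset.range w, zetaW Γ x ^ (r * i) = 0 := by
        simp_rw [mul_comm _ i, pow_mul]
        rw [geom_sum_eq hne, ← pow_mul, mul_comm, pow_mul, hprim.pow_eq_one, one_pow, sub_self, zero_div]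
      rw [this, zero_mul]
  rw [Finset.sum_congr rfl hgeom, Finset.sum_ite_eq']
  simp only [Finset.mem_range]
  rw [if_pos (width_pos Γ x)]
  have hw0 : (w : ℂ) ≠ 0 := by exact_mod_cast (width_pos Γ x).ne'
  field_simp

omit [Γ.FiniteIndex] in
/-- `cosetSlash (Tⁱ x) = transl (-i) (cosetSlash x)`. [folklore] -/
theorem transl_cosetSlash {k : ℤ} {G : ℍ → ℂ} (hG : G ∈ levelSpace Γ k) (x : 𝕏) (i : ℕ) :
    transl (-(i : ℤ)) (cosetSlash Γ k G x) = cosetSlash Γ k G (ModularGroup.T ^ i • x) := by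
  rw [← slash_T_zpow_eq_transl k, cosetSlash_slash (slash_eq_of_mem_levelSpace hG), zpow_neg, inv_inv,
    zpow_natCast]

omit [Γ.FiniteIndex] in
/-- `cosetSlash x` is `w(x)`-periodic. [folklore] -/
theorem cosetSlash_T_pow_width_smul {k : ℤ} {G : ℍ → ℂ} (hG : G ∈ levelSpace Γ k) (x : 𝕏) (τ : ℍ) :
    cosetSlash Γ k G x ((ModularGroup.T ^ (width Γ x : ℤ)) • τ) = cosetSlash Γ k G x τ := by
  have h := slash_T_zpow_eq_transl k (width Γ x : ℤ) (cosetSlash Γ k G x)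
  rw [cosetSlash_slash (slash_eq_of_mem_levelSpace hG), zpow_natCast,
    inv_smul_eq_iff.mpr (T_pow_width_smul Γ x).symm] at h
  have := congr_fun h τ
  rw [transl] at this
  exact this.symm

end CuspOrder



/-! ### Nonsingularity of the limit matrix `M₀` -/

section LimMat

variable {Γ : Subgroup SL(2, ℤ)} [Γ.FiniteIndex]

local notation "𝕏" => SL(2, ℤ) ⧸ Γ

open scoped Classical

variable {wt : Fin (Γ.index) → ℤ} {F : Fin (Γ.index) → ℍ → ℂ}

/-- The entries of `M₀` along the orbit of a base point: row `T^r · base x` carries the `r`-th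
coefficients of the rows of `base x`. [folklore] -/
theorem limMat_orbit (x : 𝕏) {r : ℕ} (hr : r < width Γ x) (j : Fin (Γ.index)) :
    limMat Γ wt F (cosetEquiv Γ (ModularGroup.T ^ r • base Γ x)) j =
      coeffAt (w := width Γ x) r (rowFun Γ wt F (base Γ x) j) := by
  unfold limMat
  rw [Equiv.symm_apply_apply, base_T_pow_smul, base_base]
  exact coeffAt_congr (by rw [width_T_pow_smul, width_base]) (off_T_pow_smul_base Γ x hr) _

omit [Γ.FiniteIndex] in
/-- Level-one multipliers with constant term `1`: for a common large even weight `M` there are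
`m_j ∈ R_{M - k_j}` with `m_j → 1` at `i∞` (monomials in `E₄`, `E₆`). [folklore] -/
theorem exists_multipliers (hwt : ∀ j, 0 ≤ wt j ∧ Even (wt j)) :
    ∃ (M : ℤ) (m : Fin (Γ.index) → ℍ → ℂ), (∀ j, m j ∈ levelOneSpace (M - wt j)) ∧
      ∀ j, Tendsto (m j) atImInfty (𝓝 1) := by
  have hT : ∀ j, wt j ≤ totalWeight Γ wt := fun j ↦ by
    unfold totalWeight
    exact Finset.single_le_sum (fun i _ ↦ (hwt i).1) (Finset.mem_univ j)
  have key : ∀ j, ∃ m : ℍ → ℂ, m ∈ levelOneSpace (2 * totalWeight Γ wt + 4 - wt j) ∧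
      Tendsto m atImInfty (𝓝 1) := by
    intro j
    obtain ⟨a, ha⟩ := (hwt j).2
    have h0 := (hwt j).1
    have hTj := hT j
    obtain ⟨n, hn⟩ : ∃ n : ℕ, 2 * totalWeight Γ wt + 4 - wt j = n :=
      ⟨(2 * totalWeight Γ wt + 4 - wt j).toNat, (Int.toNat_of_nonneg (by omega)).symm⟩
    have h4 : 4 ≤ n := by omega
    have heven : Even n := by
      rw [← Int.even_coe_nat, ← hn]
      exact ⟨totalWeight Γ wt + 2 - a, by omega⟩
    obtain ⟨m, -, hm, ht⟩ := exists_levelOne_tendsto_one h4 heven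
    exact ⟨m, hn ▸ hm, ht⟩
  choose m hm ht using key
  exact ⟨2 * totalWeight Γ wt + 4, m, hm, ht⟩

omit [Γ.FiniteIndex] in
/-- Conjugating a combination `∑ p_j F_j` with level-one coefficients conjugates the `F_j` only.
[folklore] -/
theorem cosetSlash_sum_levelOne_mul (hb : IsLevelBasis Γ wt F) {M : ℤ} {p : Fin (Γ.index) → ℍ → ℂ}
    (hp : ∀ j, p j ∈ levelOneSpace (M - wt j)) (hGmem : ∑ j, p j * F j ∈ levelSpace Γ M) (x : 𝕏) :
    cosetSlash Γ M (∑ j, p j * F j) x = ∑ j, p j * rowFun Γ wt F x j := by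
  induction x using QuotientGroup.induction_on with
  | H g =>
    rw [cosetSlash_mk (slash_eq_of_mem_levelSpace hGmem), sum_mul_slash_of_levelOne _ (fun j _ ↦ hp j)]
    refine Finset.sum_congr rfl fun j _ ↦ ?_
    rw [rowFun, cosetSlash_mk (slash_eq_of_mem_levelSpace (hb.mem j))]

/-- **`M₀` is nonsingular**: if `∑_j M₀_{a,j} c_j = 0` for all rows `a`, then `c = 0`. Proof: with
level-one multipliers `m_j → 1` of weights `M - k_j`, the form `G = ∑ c_j m_j F_j ∈ A_M` has all
projections `K_r(G ∣ b) → ∑_j c_j M₀ = 0`, so every conjugate of `G` is `O(e^{-2πy})`; hence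
`G/Δ ∈ A_{M-12}`, and expanding `G/Δ = ∑ p'_j F_j` the uniqueness in the level-one basis gives
`c_j m_j = Δ p'_j`; at `i∞` the left side tends to `c_j`, the right side to `0`. [folklore] -/
theorem limMat_mulVec_eq_zero (hb : IsLevelBasis Γ wt F) (hwt : ∀ j, 0 ≤ wt j ∧ Even (wt j))
    {c : Fin (Γ.index) → ℂ} (hc : (limMat Γ wt F).mulVec c = 0) : c = 0 := by
  obtain ⟨M, m, hm, ht⟩ := exists_multipliers (Γ := Γ) (wt := wt) hwt
  -- the test form `G = ∑ c_j m_j F_j`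
  set p : Fin (Γ.index) → ℍ → ℂ := fun j ↦ c j • m j with hp
  have hpmem : ∀ j, p j ∈ levelOneSpace (M - wt j) := fun j ↦ Submodule.smul_mem _ _ (hm j)
  have hpt : ∀ j, Tendsto (p j) atImInfty (𝓝 (c j)) := fun j ↦ by
    rw [show p j = fun τ ↦ c j * m j τ from rfl]
    simpa using (ht j).const_mul (c j)
  set G : ℍ → ℂ := ∑ j, p j * F j with hG
  have hGmem : G ∈ levelSpace Γ M := by
    refine Submodule.sum_mem _ fun j _ ↦ ?_
    have := levelOne_mul_mem Γ (hpmem j) (hb.mem j)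
    rwa [sub_add_cancel] at this
  have hslash : ∀ x : 𝕏, cosetSlash Γ M G x = ∑ j, p j * rowFun Γ wt F x j :=
    cosetSlash_sum_levelOne_mul hb hpmem hGmem
  have hperG : ∀ x : 𝕏, ∀ τ, cosetSlash Γ M G (base Γ x) ((ModularGroup.T ^ (width Γ x : ℤ)) • τ) =
      cosetSlash Γ M G (base Γ x) τ := fun x τ ↦ by
    have := cosetSlash_T_pow_width_smul hGmem (base Γ x) τ
    rwa [width_base] at this
  have hperF : ∀ x : 𝕏, ∀ j τ, rowFun Γ wt F (base Γ x) j ((ModularGroup.T ^ (width Γ x : ℤ)) • τ) =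
      rowFun Γ wt F (base Γ x) j τ := fun x j τ ↦ by
    have := rowFun_T_pow_width_smul hb (base Γ x) j τ
    rwa [width_base] at this
  -- Step 1: all projections of `G ∣ base x` decay
  have hcoef : ∀ x : 𝕏, ∀ r < width Γ x,
      twistAvg (width Γ x) r (cosetSlash Γ M G (base Γ x)) =O[atImInfty]
        fun τ : ℍ ↦ Real.exp (-2 * π * τ.im) := by
    intro x r hr
    refine isBigO_twistAvg_of_coeffAt_eq_zero hr (hperG x) (mdifferentiable_cosetSlash hGmem _)
      (isBoundedAtImInfty_cosetSlash hGmem _) ?_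
    have hlim := tendsto_twistAvg hr (hperG x) (mdifferentiable_cosetSlash hGmem _)
      (isBoundedAtImInfty_cosetSlash hGmem _)
    have hlim' : Tendsto (twistAvg (width Γ x) r (cosetSlash Γ M G (base Γ x))) atImInfty (𝓝 0) := by
      have heq : twistAvg (width Γ x) r (cosetSlash Γ M G (base Γ x)) =
          fun τ ↦ ∑ j, p j τ * twistAvg (width Γ x) r (rowFun Γ wt F (base Γ x) j) τ := by
        funext τ
        rw [hslash, twistAvg_sum_levelOne_mul _ _ _ (fun j _ ↦ hpmem j)]
      rw [heq]
      have hrow : ∀ j, Tendsto (fun τ ↦ p j τ * twistAvg (width Γ x) r (rowFun Γ wt F (base Γ x) j) τ)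
          atImInfty (𝓝 (c j * coeffAt (w := width Γ x) r (rowFun Γ wt F (base Γ x) j))) := fun j ↦
        (hpt j).mul (tendsto_twistAvg hr (hperF x j) (mdifferentiable_cosetSlash (hb.mem j) _)
          (isBoundedAtImInfty_cosetSlash (hb.mem j) _))
      have hsum := tendsto_finsetSum Finset.univ fun j _ ↦ hrow j
      have h0 : ∑ j, c j * coeffAt (w := width Γ x) r (rowFun Γ wt F (base Γ x) j) = 0 := by
        have := congr_fun hc (cosetEquiv Γ (ModularGroup.T ^ r • base Γ x))
        rw [Matrix.mulVec, dotProduct, Pi.zero_apply] at this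
        rw [← this]
        refine Finset.sum_congr rfl fun j _ ↦ ?_
        rw [limMat_orbit x hr, mul_comm]
      rwa [h0] at hsum
    exact tendsto_nhds_unique hlim hlim'
  -- Step 2: every conjugate of `G` decays
  have hdecay : ∀ y : 𝕏, cosetSlash Γ M G y =O[atImInfty] fun τ : ℍ ↦ Real.exp (-2 * π * τ.im) := by
    intro y
    have hy : cosetSlash Γ M G y = transl (-(off Γ y : ℤ)) (cosetSlash Γ M G (base Γ y)) := by
      rw [transl_cosetSlash hGmem, T_pow_off_smul_base]
    rw [hy]
    refine isBigO_transl _ ?_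
    have heq : cosetSlash Γ M G (base Γ y) = fun τ : ℍ ↦ ∑ r ∈ Finset.range (width Γ y),
        Function.Periodic.qParam (width Γ y) τ ^ r * twistAvg (width Γ y) r (cosetSlash Γ M G (base Γ y)) τ := by
      funext τ
      exact (sum_qParam_pow_mul_twistAvg y τ).symm
    rw [heq]
    refine IsBigO.sum fun r hr ↦ ?_
    have hq : (fun τ : ℍ ↦ Function.Periodic.qParam (width Γ y) τ ^ r) =O[atImInfty] fun _ : ℍ ↦ (1 : ℝ) :=
      IsBigO.of_bound 1 (Filter.Eventually.of_forall fun τ ↦ by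
        rw [norm_one, mul_one]; exact norm_qParam_pow_le _ _ _)
    have := hq.mul (hcoef y r (Finset.mem_range.mp hr))
    simpa using this
  -- Step 3: `g = G/Δ ∈ A_{M-12}`
  set g : ℍ → ℂ := fun τ ↦ G τ / ModularForm.discriminant τ with hg
  have hgmem : g ∈ levelSpace Γ (M - 12) := by
    rw [mem_formSpace_iff]
    refine ⟨?_, ?_, ?_⟩
    · intro τ
      rw [UpperHalfPlane.mdifferentiableAt_iff]
      exact (UpperHalfPlane.mdifferentiableAt_iff.mp (mdifferentiable_of_mem_formSpace hGmem τ)).div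
        (UpperHalfPlane.mdifferentiableAt_iff.mp (CuspForm.discriminant.holo' τ))
        (by simpa [ofComplex_apply] using discriminant_ne_zero τ)
    · rintro _ ⟨γ, hγ, rfl⟩
      show (fun τ ↦ G τ / ModularForm.discriminant τ) ∣[M - 12] (γ : GL (Fin 2) ℝ) = _
      rw [div_discriminant_slash, slash_eq_of_mem_levelSpace hGmem γ hγ]
    · intro g'
      show IsBoundedAtImInfty ((fun τ ↦ G τ / ModularForm.discriminant τ) ∣[M - 12] (g' : GL (Fin 2) ℝ))
      rw [div_discriminant_slash]
      have : G ∣[M] (g' : GL (Fin 2) ℝ) = cosetSlash Γ M G ((g'⁻¹ : SL(2, ℤ)) : 𝕏) := by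
        rw [cosetSlash_mk (slash_eq_of_mem_levelSpace hGmem), inv_inv]
      rw [this]
      exact isBoundedAtImInfty_div_discriminant (hdecay _)
  -- Step 4: compare the two expansions of `G`
  obtain ⟨p', hp'mem, hp'eq⟩ := hb.span (M - 12) g hgmem
  have hΔmem : (ModularForm.discriminant : ℍ → ℂ) ∈ levelOneSpace 12 :=
    coe_mem_formSpace (CuspForm.discriminant : ModularForm 𝒮ℒ 12)
  have hcoefmem : ∀ j, p j - ModularForm.discriminant * p' j ∈ levelOneSpace (M - wt j) := by
    intro j
    refine Submodule.sub_mem _ (hpmem j) ?_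
    have := mul_mem_formSpace hΔmem (hp'mem j)
    rwa [show (12 : ℤ) + (M - 12 - wt j) = M - wt j by ring] at this
  have hrel : ∑ j, (p j - ModularForm.discriminant * p' j) * F j = 0 := by
    have h1 : ∀ τ, ModularForm.discriminant τ * g τ = G τ := fun τ ↦ by
      rw [hg]
      exact mul_div_cancel₀ _ (discriminant_ne_zero τ)
    funext τ
    have h2 := h1 τ
    rw [hp'eq] at h2
    simp only [Finset.sum_apply, Pi.mul_apply, Finset.mul_sum] at h2
    have h3 : G τ = ∑ j, p j τ * F j τ := by simp [hG, Finset.sum_apply]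
    simp only [Finset.sum_apply, Pi.mul_apply, Pi.sub_apply, Pi.zero_apply, sub_mul,
      Finset.sum_sub_distrib]
    rw [← h3, ← h2]
    simp only [mul_assoc, sub_self]
  have hzero := hb.indep M _ hcoefmem hrel
  -- Step 5: constant terms
  funext j
  rw [Pi.zero_apply]
  have hbd : IsBoundedAtImInfty (p' j) := by
    have := isBoundedAtImInfty_slash_of_mem_formSpace (hp'mem j) 1
    simpa using this
  have h0 : (ModularForm.discriminant : ℍ → ℂ) =o[atImInfty] (fun _ : ℍ ↦ (1 : ℝ)) :=
    (Asymptotics.isLittleO_one_iff ℝ).mpr discriminant_isZeroAtImInfty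
  have hlim0 : Tendsto (fun τ ↦ ModularForm.discriminant τ * p' j τ) atImInfty (𝓝 0) := by
    have := h0.mul_isBigO hbd
    simp only [Pi.one_apply, mul_one] at this
    exact (Asymptotics.isLittleO_one_iff ℝ).mp this
  have heq : p j = fun τ ↦ ModularForm.discriminant τ * p' j τ := by
    have := hzero j
    rw [sub_eq_zero] at this
    rw [this]
    rfl
  exact tendsto_nhds_unique (heq ▸ hpt j) hlim0

end LimMat


/-! ### The cusp order of `𝒟`: `∑ k_j = 12 t`, and `2t = μ - ν_∞` -/

section CuspWeight

variable {Γ : Subgroup SL(2, ℤ)} [Γ.FiniteIndex]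

local notation "𝕏" => SL(2, ℤ) ⧸ Γ

open scoped Classical

variable {wt : Fin (Γ.index) → ℤ} {F : Fin (Γ.index) → ℍ → ℂ}

/-- `det M₀ ≠ 0`. [folklore] -/
theorem det_limMat_ne_zero (hb : IsLevelBasis Γ wt F) (hwt : ∀ j, 0 ≤ wt j ∧ Even (wt j)) :
    (limMat Γ wt F).det ≠ 0 := by
  intro h
  obtain ⟨v, hv, hMv⟩ := Matrix.exists_mulVec_eq_zero_iff.mpr h
  exact hv (limMat_mulVec_eq_zero hb hwt hMv)

/-- **Exact decay rate of `𝒟` at `i∞`**: `‖𝒟(τ)‖ e^{2π t Im τ} → ‖det M₀‖/‖det L‖ > 0`, from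
`L · Φ = diag(q_w^{off}) · H`, `H → M₀`. [folklore] -/
theorem tendsto_norm_basisDet_mul_exp (hb : IsLevelBasis Γ wt F) (hwt : ∀ j, 0 ≤ wt j ∧ Even (wt j)) :
    ∃ A : ℝ, 0 < A ∧ Tendsto (fun τ : ℍ ↦ ‖basisDet Γ wt F τ‖ * Real.exp (2 * π * cuspExp Γ * τ.im))
      atImInfty (𝓝 A) := by
  have hL := det_dftMat_ne_zero (Γ := Γ)
  have hM := det_limMat_ne_zero hb hwt
  refine ⟨‖(limMat Γ wt F).det‖ / ‖(dftMat Γ).det‖,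
    div_pos (norm_pos_iff.mpr hM) (norm_pos_iff.mpr hL), ?_⟩
  have key : ∀ τ : ℍ, ‖basisDet Γ wt F τ‖ * Real.exp (2 * π * cuspExp Γ * τ.im) =
      ‖(coefMat Γ wt F τ).det‖ / ‖(dftMat Γ).det‖ := by
    intro τ
    have h1 : (dftMat Γ).det * basisDet Γ wt F τ = (∏ a, qFactor Γ a τ) * (coefMat Γ wt F τ).det := by
      rw [basisDet, ← Matrix.det_mul, ← projMat_eq_mul, det_projMat hb]
    have h2 := congrArg norm h1
    rw [norm_mul, norm_mul, norm_prod_qFactor] at h2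
    rw [eq_div_iff (norm_ne_zero_iff.mpr hL)]
    have hexp : Real.exp (-2 * π * cuspExp Γ * τ.im) * Real.exp (2 * π * cuspExp Γ * τ.im) = 1 := by
      rw [← Real.exp_add]
      convert Real.exp_zero using 2
      ring
    calc ‖basisDet Γ wt F τ‖ * Real.exp (2 * π * cuspExp Γ * τ.im) * ‖(dftMat Γ).det‖
        = (‖(dftMat Γ).det‖ * ‖basisDet Γ wt F τ‖) * Real.exp (2 * π * cuspExp Γ * τ.im) := by ring
      _ = Real.exp (-2 * π * cuspExp Γ * τ.im) * ‖(coefMat Γ wt F τ).det‖ *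
            Real.exp (2 * π * cuspExp Γ * τ.im) := by rw [h2]
      _ = ‖(coefMat Γ wt F τ).det‖ := by
          rw [mul_comm (Real.exp _), mul_assoc, hexp, mul_one]
  simp_rw [key]
  exact ((tendsto_det_coefMat hb).norm).div_const _

/-- **`K = ∑ k_j = 12 t`**: comparing `‖𝒟‖¹² e^{2πKy} → C > 0` (`𝒟¹² = cΔ^K`) with
`‖𝒟‖ e^{2πty} → A > 0` forces `e^{2π(K - 12t)y}` to converge to a positive real, so `K = 12t`.
[cite: Gannon2014, Thm. 3.4(b)] -/
theorem totalWeight_eq_twelve_mul_cuspExp (hb : IsLevelBasis Γ wt F) (R : RankInput Γ) (hwt : ∀ j, 0 ≤ wt j ∧ Even (wt j)) :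
    (totalWeight Γ wt : ℝ) = 12 * cuspExp Γ := by
  have hK : 0 ≤ totalWeight Γ wt := totalWeight_nonneg hwt
  obtain ⟨C, hC, hCt⟩ := tendsto_norm_basisDet_pow hb R hK
  obtain ⟨A, hA, hAt⟩ := tendsto_norm_basisDet_mul_exp hb hwt
  set s : ℝ := (totalWeight Γ wt : ℝ) - 12 * cuspExp Γ with hs
  have hKnat : ((totalWeight Γ wt).toNat : ℝ) = (totalWeight Γ wt : ℝ) := by
    exact_mod_cast Int.toNat_of_nonneg hK
  -- `e^{2π s y} → C / A¹²`
  have hq : Tendsto (fun τ : ℍ ↦ Real.exp (2 * π * s * τ.im)) atImInfty (𝓝 (C / A ^ 12)) := by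
    have h := hCt.div (hAt.pow 12) (pow_ne_zero _ hA.ne')
    refine h.congr' (Filter.Eventually.of_forall fun τ ↦ ?_)
    have hD : 0 < ‖basisDet Γ wt F τ‖ := norm_pos_iff.mpr (basisDet_ne_zero hb R hK τ)
    simp only [Pi.div_apply]
    rw [hKnat, mul_pow, ← Real.exp_nat_mul, mul_div_mul_left _ _ (pow_ne_zero 12 hD.ne'),
      ← Real.exp_sub, hs]
    congr 1
    push_cast
    ring
  have him : Tendsto (fun τ : ℍ ↦ τ.im) atImInfty atTop := by
    rw [atImInfty]
    exact Filter.tendsto_comap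
  rcases lt_trichotomy s 0 with hneg | h0 | hpos
  · have h0' : Tendsto (fun τ : ℍ ↦ Real.exp (2 * π * s * τ.im)) atImInfty (𝓝 0) := by
      refine Real.tendsto_exp_atBot.comp ?_
      have : Tendsto (fun y : ℝ ↦ 2 * π * s * y) atTop atBot :=
        Tendsto.const_mul_atTop_of_neg (by nlinarith [Real.pi_pos]) tendsto_id
      exact this.comp him
    have := tendsto_nhds_unique hq h0'
    exact absurd this (div_pos hC (pow_pos hA 12)).ne'
  · linarith
  · have h0' : Tendsto (fun τ : ℍ ↦ Real.exp (2 * π * s * τ.im)) atImInfty atTop := by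
      refine Real.tendsto_exp_atTop.comp ?_
      have : Tendsto (fun y : ℝ ↦ 2 * π * s * y) atTop atTop :=
        Tendsto.const_mul_atTop (by positivity) tendsto_id
      exact this.comp him
    exact absurd hq (not_tendsto_nhds_of_tendsto_atTop h0' _)

/-! #### Counting: `2t = μ - #(base points)` and `#(base points) = ν_∞` -/

/-- The local `Fintype` structure on the coset space. [folklore] -/
local instance fintypeCosetCuspWeight : Fintype (SL(2, ℤ) ⧸ Γ) := Fintype.ofFinite _

variable (Γ) in
/-- The finset of base points (one per `T`-orbit, i.e. per cusp). [folklore] -/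
def basePoints : Finset 𝕏 := Finset.univ.filter fun x ↦ base Γ x = x

/-- `base x` is a base point. [folklore] -/
theorem base_mem_basePoints (x : 𝕏) : base Γ x ∈ basePoints Γ :=
  Finset.mem_filter.mpr ⟨Finset.mem_univ _, base_base Γ x⟩

/-- The fibre of `base` over a base point `b` is the orbit finset of `b`. [folklore] -/
theorem filter_base_eq (b : 𝕏) (hb : base Γ b = b) :
    (Finset.univ.filter fun x : 𝕏 ↦ base Γ x = b) = orbitFin Γ b := by
  ext x
  simp only [Finset.mem_filter, Finset.mem_univ, true_and]
  constructor
  · intro hx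
    rw [← hx]
    exact (mem_orbitFin' Γ).mpr ⟨off Γ x, T_pow_off_smul_base Γ x⟩
  · intro hx
    rw [base_eq_of_mem Γ hx, hb]

omit [Γ.FiniteIndex] in
/-- A sum over the orbit of a base point is a sum over exponents `i < w`. [folklore] -/
theorem sum_orbitFin_eq {M : Type*} [AddCommMonoid M] (b : 𝕏) (f : 𝕏 → M) :
    ∑ x ∈ orbitFin Γ b, f x = ∑ i ∈ Finset.range (width Γ b), f (ModularGroup.T ^ i • b) := by
  rw [orbitFin, Finset.sum_image]
  intro i hi i' hi' h
  exact T_pow_smul_injOn Γ b (Finset.mem_range.mp hi) (Finset.mem_range.mp hi') h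

/-- `∑_{x} off(x)/w(x)` over the orbit of a base point `b` is `(w(b) - 1)/2`. [folklore] -/
theorem sum_orbit_off_div_width (b : 𝕏) (hb : base Γ b = b) :
    ∑ x ∈ orbitFin Γ b, (off Γ x : ℝ) / width Γ x = ((width Γ b : ℝ) - 1) / 2 := by
  rw [sum_orbitFin_eq]
  have h : ∀ i ∈ Finset.range (width Γ b), (off Γ (ModularGroup.T ^ i • b) : ℝ) / width Γ (ModularGroup.T ^ i • b) =
      (i : ℝ) / width Γ b := by
    intro i hi
    have hoff := off_T_pow_smul_base Γ b (Finset.mem_range.mp hi)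
    rw [hb] at hoff
    rw [width_T_pow_smul, hoff]
  rw [Finset.sum_congr rfl h, ← Finset.sum_div]
  have hw : (0 : ℝ) < width Γ b := by exact_mod_cast width_pos Γ b
  rw [div_eq_div_iff hw.ne' two_ne_zero]
  have hg := Finset.sum_range_id_mul_two (width Γ b)
  have hcast : (∑ i ∈ Finset.range (width Γ b), (i : ℝ)) * 2 = (width Γ b : ℝ) * ((width Γ b : ℝ) - 1) := by
    have := congrArg (Nat.cast (R := ℝ)) hg
    push_cast [Nat.cast_sub (width_pos Γ b)] at this
    exact this
  linarith

/-- Powers `Tⁿ`, `n ∈ ℤ`, act on cosets like powers with exponents in `ℕ`. [folklore] -/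
theorem exists_T_zpow_smul_eq (y : 𝕏) (n : ℤ) :
    ∃ i : ℕ, (ModularGroup.T ^ n) • y = ModularGroup.T ^ i • y := by
  set w : ℕ := width Γ y with hw
  refine ⟨(n % w).toNat, ?_⟩
  have hN : (w : ℤ) ≠ 0 := by exact_mod_cast (width_pos Γ y).ne'
  have hmod : 0 ≤ n % w := Int.emod_nonneg _ hN
  have hfix : ∀ m : ℤ, (ModularGroup.T ^ ((w : ℤ) * m)) • y = y := by
    intro m
    rw [zpow_mul, zpow_natCast]
    have hmem : ModularGroup.T ^ w ∈ MulAction.stabilizer SL(2, ℤ) y := T_pow_width_smul Γ y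
    exact (MulAction.stabilizer SL(2, ℤ) y).zpow_mem hmem m
  conv_lhs => rw [← Int.emod_add_mul_ediv n w]
  rw [zpow_add, mul_smul, hfix, ← zpow_natCast, Int.toNat_of_nonneg hmod]

/-- `base (Tⁿ x) = base x` for `n ∈ ℤ`. [folklore] -/
theorem base_T_zpow_smul (y : 𝕏) (n : ℤ) : base Γ ((ModularGroup.T ^ n) • y) = base Γ y := by
  obtain ⟨i, hi⟩ := exists_T_zpow_smul_eq y n
  rw [hi, base_T_pow_smul]

/-- `base x` lies in the `⟨T⟩`-orbit class of `x`: `T^{-off x} x = base x`. [folklore] -/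
theorem T_zpow_neg_off_smul (x : 𝕏) : (ModularGroup.T ^ (-(off Γ x : ℤ))) • x = base Γ x := by
  rw [zpow_neg, inv_smul_eq_iff, zpow_natCast, T_pow_off_smul_base]

variable (Γ) in
/-- **Base points `≃` `T`-orbits** (`= cusps`). [folklore] -/
def basePointsEquiv :
    MulAction.orbitRel.Quotient (Subgroup.zpowers (ModularGroup.T : SL(2, ℤ))) 𝕏 ≃ {x // x ∈ basePoints Γ} where
  toFun := Quotient.lift (fun x ↦ (⟨base Γ x, base_mem_basePoints x⟩ : {x // x ∈ basePoints Γ})) (by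
    intro x y hxy
    obtain ⟨⟨g, hg⟩, hgy⟩ := MulAction.orbitRel_apply.mp hxy
    obtain ⟨n, rfl⟩ := Subgroup.mem_zpowers_iff.mp hg
    refine Subtype.ext ?_
    simp only
    rw [← hgy]
    exact base_T_zpow_smul y n)
  invFun x := Quotient.mk _ x.1
  left_inv q := Quotient.inductionOn q fun x ↦ Quotient.sound (MulAction.orbitRel_apply.mpr
    ⟨⟨ModularGroup.T ^ (-(off Γ x : ℤ)), Subgroup.mem_zpowers_iff.mpr ⟨_, rfl⟩⟩, T_zpow_neg_off_smul x⟩)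
  right_inv x := Subtype.ext (Finset.mem_filter.mp x.2).2

/-- **`2t = μ - ν_∞`**: on each orbit the offsets are `0, …, w - 1`, contributing `(w-1)/2`, and
`∑ w = μ`. [folklore] -/
theorem two_mul_cuspExp : 2 * cuspExp Γ = Γ.index - (basePoints Γ).card := by
  unfold cuspExp
  have h1 : ∑ a : Fin (Γ.index), (off Γ ((cosetEquiv Γ).symm a) : ℝ) / width Γ ((cosetEquiv Γ).symm a) =
      ∑ x : 𝕏, (off Γ x : ℝ) / width Γ x :=
    Equiv.sum_comp (cosetEquiv Γ).symm (fun x ↦ (off Γ x : ℝ) / width Γ x)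
  rw [h1, ← Finset.sum_fiberwise_of_maps_to (s := Finset.univ) (t := basePoints Γ) (g := base Γ)
    (fun x _ ↦ base_mem_basePoints x)]
  have h2 : ∀ b ∈ basePoints Γ, ∑ x ∈ Finset.univ.filter (fun x : 𝕏 ↦ base Γ x = b),
      (off Γ x : ℝ) / width Γ x = ((width Γ b : ℝ) - 1) / 2 := by
    intro b hb
    have hb' : base Γ b = b := (Finset.mem_filter.mp hb).2
    rw [filter_base_eq b hb', sum_orbit_off_div_width b hb']
  rw [Finset.sum_congr rfl h2, ← Finset.sum_div]
  have h3 : ∑ b ∈ basePoints Γ, (width Γ b : ℝ) = Γ.index := by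
    have hc := Finset.card_eq_sum_card_fiberwise (s := (Finset.univ : Finset 𝕏)) (t := basePoints Γ)
      (f := base Γ) (fun x _ ↦ base_mem_basePoints x)
    have hfib : ∀ b ∈ basePoints Γ, (Finset.univ.filter (fun x : 𝕏 ↦ base Γ x = b)).card = width Γ b :=
      fun b hb ↦ by rw [filter_base_eq b (Finset.mem_filter.mp hb).2, card_orbitFin]
    have : (Finset.univ : Finset 𝕏).card = ∑ b ∈ basePoints Γ, width Γ b := by
      rw [hc]
      exact Finset.sum_congr rfl hfib
    rw [Finset.card_univ, ← Nat.card_eq_fintype_card, ← Subgroup.index] at this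
    exact_mod_cast this.symm
  rw [Finset.sum_sub_distrib, h3, Finset.sum_const, nsmul_eq_mul, mul_one]
  ring

/-- **The cusp constraint on the weights**: `∑_j k_j = 6(μ - ν_∞)`. [cite: Gannon2014, Thm. 3.4(b)] -/
theorem totalWeight_eq (hb : IsLevelBasis Γ wt F) (R : RankInput Γ) (hwt : ∀ j, 0 ≤ wt j ∧ Even (wt j)) :
    totalWeight Γ wt + 6 * (basePoints Γ).card = 6 * Γ.index := by
  have h1 := totalWeight_eq_twelve_mul_cuspExp hb R hwt
  have h2 := two_mul_cuspExp (Γ := Γ)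
  have h3 : (totalWeight Γ wt : ℝ) + 6 * (basePoints Γ).card = 6 * Γ.index := by linarith
  exact_mod_cast h3

end CuspWeight



/-! ### Bookkeeping: `dim M₂(Γ) = #{j : k_j = 2} ≥ g - 1 + ν_∞` -/

end Level

end Literature.NumberTheory.EllipticCurves.ModularForms
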